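import Summits.ValiantsHypothesis.ValiantsHypothesis.Theorems.BarrierLeverChowBenchmarkPairsBlockPeelConfluent4Rows

/-!
# Route BarrierLever — item 22038 `ChowBenchmarkPairs`, line `moore-peel`: the BLOCK PEEL, IX-b — the CONFLUENT QUADRUPLE
# CRITERION, part 2: the six internal pair rows (leading orders `0,1,2,2,3,4`)

Helper file (`--supports stmt-ValiantsHypothesis-22038`; cell valiant-natproofs, rung V4, line `moore_peel`; seat val-np-p4 gen 31).
Closes NO item; definition-light (two bookkeeping tables).  See `…BlockPeelConfluent4Rows` for the setting.

CONTENT.  The six internal pair rows `p_{ab} = Σ_{d⊆T_B} κ|B∖d|κ|d|·(1+aX)^{B-d}(1+bX)^d` (`0 ≤ a < b ≤ 3`) are recombined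
with the integer table `confPCoef4` (slots `p01`, `p02-p01`, `p12-p03`, `p01-2p02+p03`, `-p01+2p02-2p13+p23`,
`p01-4p02+3p03+3p12-4p13+p23`).  `coeff_confRed4_pair`: the `X^k`-coefficient of slot `σ` is `Σ_d κ|B∖d|κ|d|·pairBracket4 σ k`,
an explicit integer polynomial in the binomials of `e = B-d` and `d`; below the leading order the bracket is ANTISYMMETRIC under
`e ↔ d` (`pairBracket4_antisymm`), so the coefficient vanishes by the involution `d ↦ T_B∖d` (`sum_pairW_antisymm`); at the
leading order it is the row of `C₄` (`pairBracket4_lead`).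

WHAT THIS IS NOT: nothing on node #1, on crux stmt-ValiantsHypothesis-14610 or on `VP` versus `VNP`.
-/

set_option linter.dupNamespace false
set_option linter.unnecessarySeqFocus false

namespace Summit.ValiantsHypothesis.ValiantsHypothesis.Theorems.BarrierLever.MoorePeel

open Polynomial Finset

/-! ## 38. Pair rows of four tied points -/

/-- First and second point of the six pairs, slot order `p01, p02, p03, p12, p13, p23`. -/
def aPt4 : Fin 6 → Fin 4 := ![0, 0, 0, 1, 1, 2]

/-- Second point of the six pairs. -/
def bPt4 : Fin 6 → Fin 4 := ![1, 2, 3, 2, 3, 3]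

/-- Leading position of a slot. -/
def posOfSlot4 (σ : ℕ) : ℕ := if σ = 0 then 0 else if σ = 1 then 1 else if σ = 2 then 2 else if σ = 3 then 2 else if σ = 4 then 3 else 4

/-- The pair members evaluate to `pairCoef κ Λ_a Λ_b`. -/
theorem confJ4_confPairMem4 (κ : ℕ → ℕ) (i : ℕ) (m : Fin 6) (B : ℕ) :
    confJ4 κ i (confPairMem4 i m) B = pairCoef κ (confPoint4 (aPt4 m)) (confPoint4 (bPt4 m)) B := by
  unfold confJ4
  fin_cases m <;>
  · simp only [confPairMem4, aPt4, bPt4]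
    rw [blockEntry, if_neg (by simp)]
    congr 1
    apply congrArg
    ext
    simp

/-- Coefficients of a product of two confluent powers. -/
theorem coeff_confPoint4_pow_mul_pow (a b : Fin 4) (e d k : ℕ) :
    ((confPoint4 a) ^ e * (confPoint4 b) ^ d).coeff k =
      ∑ l ∈ Finset.range (k + 1), (((a : ℕ) : ℤ) ^ l * (e.choose l : ℤ)) * (((b : ℕ) : ℤ) ^ (k - l) * (d.choose (k - l) : ℤ)) := by
  rw [coeff_mul, Finset.Nat.sum_antidiagonal_eq_sum_range_succ_mk]
  refine Finset.sum_congr rfl fun l _ => ?_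
  rw [coeff_confPoint4_pow, coeff_confPoint4_pow]

/-- The coefficient bracket of slot `σ` at order `k` (a polynomial in the binomials of `e`, `d`). -/
def pairBracket4 (σ k e dd : ℕ) : ℤ :=
  ∑ m : Fin 6, (confPCoef4 σ m : ℤ) *
    ∑ l ∈ Finset.range (k + 1), ((((aPt4 m : ℕ) : ℤ) ^ l * (e.choose l : ℤ)) * ((((bPt4 m) : ℕ) : ℤ) ^ (k - l) * (dd.choose (k - l) : ℤ)))

/-- **Coefficients of the reduced pair rows**: `coeff_k = Σ_d κ|B∖d|κ|d| · pairBracket4 σ k (B-d) d`. -/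
theorem coeff_pairCombo4 (κ : ℕ → ℕ) (i : ℕ) (σ : ℕ) (B k : ℕ) :
    (∑ m : Fin 6, ((confPCoef4 σ m : ℤ) : ℤ[X]) * confJ4 κ i (confPairMem4 i m) B).coeff k =
      ∑ d ∈ (bits B).powerset, pairW κ B d * pairBracket4 σ k (bin (bits B \ d)) (bin d) := by
  rw [finsetSum_coeff]
  have step : ∀ m : Fin 6, (((confPCoef4 σ m : ℤ) : ℤ[X]) * confJ4 κ i (confPairMem4 i m) B).coeff k =
      ∑ d ∈ (bits B).powerset, (confPCoef4 σ m : ℤ) * (pairW κ B d *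
        ∑ l ∈ Finset.range (k + 1), ((((aPt4 m : ℕ) : ℤ) ^ l * ((bin (bits B \ d)).choose l : ℤ)) *
          ((((bPt4 m) : ℕ) : ℤ) ^ (k - l) * ((bin d).choose (k - l) : ℤ)))) := by
    intro m
    rw [← Polynomial.C_eq_intCast, coeff_C_mul, Int.cast_id, confJ4_confPairMem4, coeff_pairCoef, Finset.mul_sum]
    refine Finset.sum_congr rfl fun d _ => ?_
    rw [coeff_confPoint4_pow_mul_pow, pairW]
  rw [Finset.sum_congr rfl fun m _ => step m, Finset.sum_comm]
  refine Finset.sum_congr rfl fun d _ => ?_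
  rw [pairBracket4, Finset.mul_sum]
  refine Finset.sum_congr rfl fun m _ => ?_
  ring

/-- **The involution `d ↦ T_B ∖ d`** kills antisymmetric brackets. -/
theorem sum_pairW_antisymm (κ : ℕ → ℕ) (B : ℕ) (β : ℕ → ℕ → ℤ) (hβ : ∀ x y, β x y + β y x = 0) :
    ∑ d ∈ (bits B).powerset, pairW κ B d * β (bin (bits B \ d)) (bin d) = 0 := by
  have flip : ∑ d ∈ (bits B).powerset, pairW κ B d * β (bin (bits B \ d)) (bin d) =
      ∑ d ∈ (bits B).powerset, pairW κ B d * β (bin d) (bin (bits B \ d)) := by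
    refine Finset.sum_nbij' (fun d => bits B \ d) (fun d => bits B \ d) ?_ ?_ ?_ ?_ ?_
    · intro d _; exact Finset.mem_powerset.mpr Finset.sdiff_subset
    · intro d _; exact Finset.mem_powerset.mpr Finset.sdiff_subset
    · intro d hd; rw [Finset.mem_powerset] at hd; exact Finset.sdiff_sdiff_eq_self hd
    · intro d hd; rw [Finset.mem_powerset] at hd; exact Finset.sdiff_sdiff_eq_self hd
    · intro d hd; rw [Finset.mem_powerset] at hd
      simp only [pairW, Finset.sdiff_sdiff_eq_self hd]
      ring
  have h2 : (2 : ℤ) * ∑ d ∈ (bits B).powerset, pairW κ B d * β (bin (bits B \ d)) (bin d) = 0 := by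
    rw [two_mul]
    nth_rewrite 2 [flip]
    rw [← Finset.sum_add_distrib]
    refine Finset.sum_eq_zero fun d _ => ?_
    rw [← mul_add, hβ, mul_zero]
  omega

/-! ## 39. The brackets: antisymmetric below the leading order, the rows of `C₄` at the leading order -/

/-- Slot `0`: leading at order `0`. -/
theorem pairBracket4_lead0 (e dd : ℕ) : pairBracket4 0 0 e dd = confPairTerm4 0 e dd := by
  simp [pairBracket4, confPCoef4, confPairTerm4, aPt4, bPt4, Fin.sum_univ_six]

/-- Slot `1`. -/
theorem pairBracket4_lead1 (e dd : ℕ) : pairBracket4 1 1 e dd = confPairTerm4 1 e dd := by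
  simp [pairBracket4, confPCoef4, confPairTerm4, aPt4, bPt4, Fin.sum_univ_six, Finset.sum_range_succ] <;> ring

/-- Slot `1`: antisymmetric below the leading order. -/
theorem pairBracket4_anti1 (e dd : ℕ) : pairBracket4 1 0 e dd + pairBracket4 1 0 dd e = 0 := by
  simp [pairBracket4, confPCoef4, aPt4, bPt4, Fin.sum_univ_six]

/-- Slot `2` (`p12 - p03`). -/
theorem pairBracket4_lead2 (e dd : ℕ) : pairBracket4 2 2 e dd = confPairTerm4 2 e dd := by
  simp [pairBracket4, confPCoef4, confPairTerm4, aPt4, bPt4, Fin.sum_univ_six, Finset.sum_range_succ] <;> ring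

/-- Slot `2`: antisymmetric below the leading order. -/
theorem pairBracket4_anti2 (e dd k : ℕ) (hk : k < 2) : pairBracket4 2 k e dd + pairBracket4 2 k dd e = 0 := by
  interval_cases k <;>
    simp [pairBracket4, confPCoef4, aPt4, bPt4, Fin.sum_univ_six, Finset.sum_range_succ] <;> ring

/-- Slot `3` (`p01 - 2p02 + p03`). -/
theorem pairBracket4_lead3 (e dd : ℕ) : pairBracket4 3 2 e dd = confPairTerm4 3 e dd := by
  simp [pairBracket4, confPCoef4, confPairTerm4, aPt4, bPt4, Fin.sum_univ_six, Finset.sum_range_succ] <;> ring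

/-- Slot `3`: antisymmetric below the leading order. -/
theorem pairBracket4_anti3 (e dd k : ℕ) (hk : k < 2) : pairBracket4 3 k e dd + pairBracket4 3 k dd e = 0 := by
  interval_cases k <;>
    simp [pairBracket4, confPCoef4, aPt4, bPt4, Fin.sum_univ_six, Finset.sum_range_succ] <;> ring

/-- Slot `4` (`-p01 + 2p02 - 2p13 + p23`). -/
theorem pairBracket4_lead4 (e dd : ℕ) : pairBracket4 4 3 e dd = confPairTerm4 4 e dd := by
  simp [pairBracket4, confPCoef4, confPairTerm4, aPt4, bPt4, Fin.sum_univ_six, Finset.sum_range_succ] <;> ring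

/-- Slot `4`: antisymmetric below the leading order. -/
theorem pairBracket4_anti4 (e dd k : ℕ) (hk : k < 3) : pairBracket4 4 k e dd + pairBracket4 4 k dd e = 0 := by
  interval_cases k <;>
    simp [pairBracket4, confPCoef4, aPt4, bPt4, Fin.sum_univ_six, Finset.sum_range_succ] <;> ring

/-- Slot `5` (`p01 - 4p02 + 3p03 + 3p12 - 4p13 + p23`): leading at order `4`. -/
theorem pairBracket4_lead5 (e dd : ℕ) : pairBracket4 5 4 e dd = confPairTerm4 5 e dd := by
  simp [pairBracket4, confPCoef4, confPairTerm4, aPt4, bPt4, Fin.sum_univ_six, Finset.sum_range_succ] <;> ring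

/-- Slot `5`: antisymmetric below the leading order. -/
theorem pairBracket4_anti5 (e dd k : ℕ) (hk : k < 4) : pairBracket4 5 k e dd + pairBracket4 5 k dd e = 0 := by
  interval_cases k <;>
    simp [pairBracket4, confPCoef4, aPt4, bPt4, Fin.sum_univ_six, Finset.sum_range_succ] <;> ring

/-- **Below the leading position every bracket is antisymmetric.** -/
theorem pairBracket4_antisymm (σ k : ℕ) (hσ : σ ≤ 5) (hk : k < posOfSlot4 σ) (e dd : ℕ) :
    pairBracket4 σ k e dd + pairBracket4 σ k dd e = 0 := by
  unfold posOfSlot4 at hk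
  interval_cases σ
  · simp at hk
  · simp at hk; subst hk; exact pairBracket4_anti1 e dd
  · exact pairBracket4_anti2 e dd k (by simpa using hk)
  · exact pairBracket4_anti3 e dd k (by simpa using hk)
  · exact pairBracket4_anti4 e dd k (by simpa using hk)
  · exact pairBracket4_anti5 e dd k (by simpa using hk)

/-- **At the leading position the bracket is the row of `C₄`.** -/
theorem pairBracket4_lead (σ : ℕ) (hσ : σ ≤ 5) (e dd : ℕ) :
    pairBracket4 σ (posOfSlot4 σ) e dd = confPairTerm4 σ e dd := by
  unfold posOfSlot4
  interval_cases σ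
  · exact pairBracket4_lead0 e dd
  · exact pairBracket4_lead1 e dd
  · exact pairBracket4_lead2 e dd
  · exact pairBracket4_lead3 e dd
  · exact pairBracket4_lead4 e dd
  · exact pairBracket4_lead5 e dd

/-! ## 40. The pair classes of the reduced rows -/

section PairRed

variable (κ : ℕ → ℕ) (i : ℕ) (ρ : BlockIdx i 4) (B : ℕ)

/-- The slot of a pair row is `≤ 5` and its position is `posOfSlot4`. -/
theorem confSlot4_le (hq : ¬ (ρ.2 : ℕ) < i) : confSlot4 i ρ ≤ 5 ∧ confPos4 i ρ = posOfSlot4 (confSlot4 i ρ) := by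
  have h1 : (ρ.1 : ℕ) < 4 := ρ.1.2
  have h2 : (ρ.2 : ℕ) < i + (ρ.1 : ℕ) := ρ.2.2
  -- `s ∈ {1,2,3}` and `q - i < s`
  have hcases : ((ρ.1 : ℕ) = 1 ∧ (ρ.2 : ℕ) = i) ∨ ((ρ.1 : ℕ) = 2 ∧ (ρ.2 : ℕ) = i) ∨ ((ρ.1 : ℕ) = 2 ∧ (ρ.2 : ℕ) = i + 1) ∨
      ((ρ.1 : ℕ) = 3 ∧ (ρ.2 : ℕ) = i) ∨ ((ρ.1 : ℕ) = 3 ∧ (ρ.2 : ℕ) = i + 1) ∨ ((ρ.1 : ℕ) = 3 ∧ (ρ.2 : ℕ) = i + 2) := by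
    omega
  unfold confSlot4 confPos4 posOfSlot4
  rw [if_neg hq]
  rcases hcases with ⟨hs, hq'⟩ | ⟨hs, hq'⟩ | ⟨hs, hq'⟩ | ⟨hs, hq'⟩ | ⟨hs, hq'⟩ | ⟨hs, hq'⟩ <;>
    simp only [hs, hq'] <;> norm_num

/-- For a pair-class row the reduced row is the slot combination. -/
theorem confRed4_pair (hq : ¬ (ρ.2 : ℕ) < i) :
    confRed4 κ i ρ B = ∑ m : Fin 6, ((confPCoef4 (confSlot4 i ρ) m : ℤ) : ℤ[X]) * confJ4 κ i (confPairMem4 i m) B := by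
  unfold confRed4; rw [dif_neg hq]

/-- **Pair class: the coefficients below the position vanish.** -/
theorem coeff_confRed4_pair_lt (hq : ¬ (ρ.2 : ℕ) < i) (k : ℕ) (hk : k < confPos4 i ρ) :
    (confRed4 κ i ρ B).coeff k = 0 := by
  obtain ⟨hσ, hpos⟩ := confSlot4_le i ρ hq
  rw [confRed4_pair κ i ρ B hq, coeff_pairCombo4]
  exact sum_pairW_antisymm κ B _ (pairBracket4_antisymm _ k hσ (by rw [← hpos]; exact hk))

/-- **Pair class: the coefficient at the position is the entry of `C₄`.** -/
theorem coeff_confRed4_pair_pos (hq : ¬ (ρ.2 : ℕ) < i) :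
    (confRed4 κ i ρ B).coeff (confPos4 i ρ) = confEntry4 κ i ρ B := by
  obtain ⟨hσ, hpos⟩ := confSlot4_le i ρ hq
  rw [confRed4_pair κ i ρ B hq, coeff_pairCombo4, confEntry4, if_neg hq, confPair4, hpos]
  refine Finset.sum_congr rfl fun d _ => ?_
  rw [pairBracket4_lead _ hσ]

end PairRed

end Summit.ValiantsHypothesis.ValiantsHypothesis.Theorems.BarrierLever.MoorePeel
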